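import Summits.AtomisticToContinuum.BoseEinsteinCondensation.Theorems.BECProbeMassFlowRecoilTransferBoseTransferOne
import HarnessLib

/-!
# Route `BECProbeMassFlow`, crux `RecoilTransfer` (stmt-AtomisticToContinuum-12311):
# the crux REDUCED to the mass flow on the zero-momentum sector

Support file for the crux `RecoilTransfer` ("recoil costs at most ε"), line `registered` (skeleton
`Cruxes/RecoilTransfer/Lines/birth.lean`, v7): the sorry-free part of the skeleton, landed as the conditional
theorem `recoilTransfer_of_massFlowZeroMomentum : (mass flow on the Q = 0 sector) → RecoilTransfer`, whose
hypothesis is VERBATIM the body of the one remaining registered stub `stub_massFlowZeroMomentum` (the crux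
proper: at low density, eventually in `N`, floors `A ≥ a` on the zero-total-momentum near-minimisers of the
mass-deformed tagged Hamiltonians `H_κ`, `κ ∈ (0, κ₀]`, give the floor `A ≥ a - ε` on the zero-total-momentum
near-minimisers of `H_1`; in the pinned frame: ground states of `H_imp + κP_bath²` versus `H_imp + P_bath²`).
Everything else the crux needs is PROVED here or imported:

* the static endpoint on the `Q = 0` sector (`recoilTransfer_staticEndpoint_zero_of`), from the landed
  zero-momentum lift/descent `stub_zeroMomentumLift` (p145142) / `stub_zeroMomentumDescent` (p147854): a
  `w₀`-floor `c` on the pinned `δ₁`-near-minimisers is a floor `A ≥ c` on the `Q = 0` near-minimisers of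
  `H_κ` for `κ ≤ κ₀(δ₁, N, E_imp)`, with no loss;
* the transfer at `κ = 1` from `Q = 0` tagged near-minimisers of `H_1` (= the `(N+1)`-BOSON Hamiltonian,
  bosonic floor `taggedPeriodicGroundStateEnergy_one_eq`) to ALL Bose near-minimisers, by a three-way split
  on the profile `v`: (a) locally bounded on `(0, ∞)` — Ky Fan gap `kyFanGap_of_locallyBounded` (sibling
  crux, landed), (b) integrable — `PeriodicGroundStateNondegenerateIntegrable_holds` (Reed–Simon XIII.48(a) on
  the torus), in both cases with the tree's clustering `exists_phase_integral_norm_sub_sq_le_of_kyFanGap`, the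
  `n₀`-transfer `le_condensateOccupation_nearMinimiser_of_clustering` and the landed Bose zero-momentum
  attainment `stub_boseZeroMomentumAttain` (p156119) (`recoilTransfer_boseTransfer_gap`); (c) hard walls —
  NO Ky Fan gap (open "Lemma G" / false for tuned hard shells) but the landed
  `stub_groundStatesTranslationInvariant` (p159906: every maximal-form ground state is translation invariant,
  for every repulsive finite-range `v`, by the finite-dimensional-sublattice atom argument — no connectivity of
  the hard-sphere configuration space) and `stub_nearMinimisersNearZeroMomentum_of_invariant` (p158523:
  near-minimisers are `L²`-close to zero-momentum near-minimisers), assembled in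
  `recoilTransfer_hardWallNearZeroMomentum`, then the `2(N+1)‖·‖` Lipschitz bound on `n₀`
  (`recoilTransfer_boseTransfer_nearZeroMomentum`);
* the degenerate branch `E_imp = ⊤` (`recoilTransfer_exists_zeroWeight`: for `N ≥ 1` the symmetrised plane
  wave has no zero-momentum component; `N = 0` has `E_imp = 0`).

The physics of the remaining hypothesis is discussed in the stub's docstring in the skeleton; modulo the
sibling crux `CloudMomentumAtom` it is equivalent to complete condensation of the `(N+1)`-boson torus gas
(refuter evidence `Sandwich.lean` on the item).
-/

noncomputable section

open MeasureTheory Filter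
open scoped ENNReal NNReal

namespace Summit.AtomisticToContinuum.BoseEinsteinCondensation.Theorems

open Literature.MathematicalPhysics.QuantumManyBody
open Literature.MathematicalPhysics.QuantumManyBody.BoseGas
open Summit.AtomisticToContinuum.BoseEinsteinCondensation.Theses.BECProbeMassFlow
open Summit.AtomisticToContinuum.BoseEinsteinCondensation.Cruxes.CloudMomentumAtom.Birth (kyFanGap_of_locallyBounded)

/-! ### Glue I (sorry-free): the static endpoint on the zero-momentum sector, from A1 + A2 -/

/-- From `W ≤ L⁶ · A` and the floor `c L⁶ ≤ W`: `c ≤ A` (cancel `L⁶ ∈ (0, ∞)` in `ℝ≥0∞`).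
[folklore] -/
theorem recoilTransfer_ofReal_le_of_floor {L c : ℝ} (hL : 0 < L) {W A : ℝ≥0∞}
    (hfloor : ENNReal.ofReal (c * L ^ 6) ≤ W) (hW : W ≤ ENNReal.ofReal (L ^ 6) * A) :
    ENNReal.ofReal c ≤ A := by
  rcases le_or_gt c 0 with hc | hc
  · rw [ENNReal.ofReal_of_nonpos hc]
    exact bot_le
  · have hL6 : 0 < L ^ 6 := by positivity
    have h : ENNReal.ofReal c * ENNReal.ofReal (L ^ 6) ≤ A * ENNReal.ofReal (L ^ 6) := by
      rw [← ENNReal.ofReal_mul hc.le, mul_comm A]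
      exact hfloor.trans hW
    exact (ENNReal.mul_le_mul_iff_left (ENNReal.ofReal_pos.2 hL6).ne' ENNReal.ofReal_ne_top).1 h

/-- **The static endpoint on the `Q = 0` sector (old `stub_staticEndpoint` minus Perron–Frobenius),
from stubs A1 + A2.** At fixed `(N, L)`, a `w₀`-floor `c` on the δ₁-near-minimisers of the pinned
problem forces, for `κ ≤ κ₀(δ₁, N, E_imp)` and `δ = (δ₁ ∧ 1)/4`, the floor `A ≥ c` (no loss) on every
δ-near-minimiser of `H_κ` of total momentum `0`: its bath factor is a δ₁-near-minimiser because
`E_κ ≤ (1 + κN)(E_imp + s)`. [folklore] -/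
theorem recoilTransfer_staticEndpoint_zero_of {v : ℝ → ℝ≥0∞} (hv : Measurable v) {N : ℕ} {L : ℝ} (hL : 0 < L)
    (c : ℝ) {δ₁ : ℝ≥0∞} (hδ₁ : 0 < δ₁)
    (hfloor : ∀ Φ : PeriodicTrialState N L,
      impurityPeriodicEnergy v 0 Φ ≤ impurityPeriodicGroundStateEnergy v N L 0 + δ₁ →
        ENNReal.ofReal (c * L ^ 6) ≤
          ∫⁻ X in cellN N L, (‖∫ t in cell L, Φ.ψ (X + fun _ => t)‖₊ : ℝ≥0∞) ^ 2) :
    ∃ κ₀ : ℝ, 0 < κ₀ ∧ κ₀ ≤ 1 ∧ ∀ κ : ℝ, 0 < κ → κ ≤ κ₀ →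
      ∃ δ : ℝ≥0∞, 0 < δ ∧ ∀ Ψ : TaggedPeriodicTrialState N L, HasTotalMomentum 0 Ψ.ψ →
        taggedPeriodicEnergy v κ Ψ ≤ taggedPeriodicGroundStateEnergy v κ N L + δ →
          ENNReal.ofReal c ≤ taggedZeroModeOccupation N L Ψ.ψ := by
  set E := impurityPeriodicGroundStateEnergy v N L 0 with hE_def
  by_cases hE : E = ⊤
  · -- every pinned state is a δ₁-near-minimiser: the floor holds for all of them
    refine ⟨1, one_pos, le_rfl, fun κ _ _ => ⟨1, one_pos, fun Ψ hQ _ => ?_⟩⟩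
    obtain ⟨Φ, _, hW⟩ := stub_zeroMomentumDescent v hv N L κ Ψ hQ
    refine recoilTransfer_ofReal_le_of_floor hL (hfloor Φ ?_) hW
    rw [hE, top_add]
    exact le_top
  · -- finite pinned infimum: pick an `s`-near-minimiser `χ`, `s = (δ₁ ∧ 1)/4`
    set δ₁' : ℝ≥0∞ := min δ₁ 1 with hδ₁'_def
    have hδ₁'top : δ₁' ≠ ⊤ := ne_top_of_le_ne_top ENNReal.one_ne_top (min_le_right _ _)
    have hδ₁'pos : 0 < δ₁' := lt_min hδ₁ one_pos
    set s : ℝ≥0∞ := δ₁' / 4 with hs_def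
    have hs : 0 < s := ENNReal.div_pos hδ₁'pos.ne' (by norm_num)
    have hstop : s ≠ ⊤ := ENNReal.div_ne_top hδ₁'top (by norm_num)
    have hEs : E < E + s := ENNReal.lt_add_right hE hs.ne'
    obtain ⟨χ, hχ⟩ : ∃ χ : PeriodicTrialState N L, impurityPeriodicEnergy v 0 χ < E + s :=
      iInf_lt_iff.1 hEs
    -- the recoil budget `M = N (E + s)` and the mass threshold `κ₀`
    set M : ℝ≥0∞ := (N : ℝ≥0∞) * (E + s) with hM_def
    have hMtop : M ≠ ⊤ := ENNReal.mul_ne_top (ENNReal.natCast_ne_top N)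
      (ENNReal.add_ne_top.2 ⟨hE, hstop⟩)
    have hM1 : M + 1 ≠ 0 := by positivity
    have hM1top : M + 1 ≠ ⊤ := ENNReal.add_ne_top.2 ⟨hMtop, ENNReal.one_ne_top⟩
    set q : ℝ≥0∞ := s / (M + 1) with hq_def
    have hqtop : q ≠ ⊤ := ENNReal.div_ne_top hstop hM1
    have hqpos : 0 < q := ENNReal.div_pos hs.ne' hM1top
    refine ⟨min 1 q.toReal, lt_min one_pos (ENNReal.toReal_pos hqpos.ne' hqtop), min_le_left _ _,
      fun κ hκ hκle => ⟨s, hs, fun Ψ hQ hΨ => ?_⟩⟩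
    -- `ofReal κ * M ≤ s`
    have hκq : ENNReal.ofReal κ ≤ q := by
      rw [← ENNReal.ofReal_toReal hqtop]
      exact ENNReal.ofReal_le_ofReal (hκle.trans (min_le_right _ _))
    have hκM : ENNReal.ofReal κ * M ≤ s :=
      calc ENNReal.ofReal κ * M ≤ q * (M + 1) := mul_le_mul' hκq le_self_add
        _ = s := ENNReal.div_mul_cancel hM1 hM1top
    -- the lift bounds `E_κ`
    have hlift : taggedPeriodicGroundStateEnergy v κ N L ≤ E + s + s :=
      calc taggedPeriodicGroundStateEnergy v κ N L
          ≤ (1 + ENNReal.ofReal κ * N) * impurityPeriodicEnergy v 0 χ :=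
            stub_zeroMomentumLift v hv N L hL κ χ
        _ ≤ (1 + ENNReal.ofReal κ * N) * (E + s) := by gcongr
        _ = (E + s) + ENNReal.ofReal κ * M := by rw [add_mul, one_mul, hM_def, mul_assoc]
        _ ≤ E + s + s := by gcongr
    -- the descent: the bath factor is a δ₁-near-minimiser
    obtain ⟨Φ, hΦE, hW⟩ := stub_zeroMomentumDescent v hv N L κ Ψ hQ
    refine recoilTransfer_ofReal_le_of_floor hL (hfloor Φ ?_) hW
    have h3 : s + s + s ≤ δ₁ := by
      calc s + s + s = 3 * (δ₁' / 4) := by rw [hs_def]; ring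
        _ ≤ 4 * (δ₁' / 4) := by gcongr; norm_num
        _ = δ₁' := ENNReal.mul_div_cancel (by norm_num) (by norm_num)
        _ ≤ δ₁ := min_le_left _ _
    calc impurityPeriodicEnergy v 0 Φ ≤ taggedPeriodicEnergy v κ Ψ := hΦE
      _ ≤ taggedPeriodicGroundStateEnergy v κ N L + s := hΨ
      _ ≤ E + s + s + s := by gcongr
      _ = E + (s + s + s) := by ring
      _ ≤ E + δ₁ := by gcongr

/-! ### Glue III (sorry-free): the degenerate branch `E_imp = ⊤` -/

/-- For `N ≥ 1` bosons there is a pinned trial state with NO zero-total-momentum component: the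
normalised symmetrised plane wave `∑ⱼ e^{2πi 𝟙·xⱼ/L}` has `∫_cell Φ(X + t𝟙) dt = 0` for every `X`
(`e(x + t) = e(x) e(t)` and `∫_cell e = 0`), hence `W(Φ) = 0`. [folklore] -/
theorem recoilTransfer_exists_zeroWeight {N : ℕ} {L : ℝ} (hL : 0 < L) (hN : 0 < N) :
    ∃ Φ : PeriodicTrialState N L,
      ∫⁻ X in cellN N L, (‖∫ t in cell L, Φ.ψ (X + fun _ => t)‖₊ : ℝ≥0∞) ^ 2 = 0 := by
  set n : Fin 3 → ℤ := fun _ => 1 with hn_def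
  have hn : n ≠ 0 := by
    intro h
    have := congrFun h 0
    simp [hn_def] at this
  refine ⟨PeriodicTrialState.planeWave hL hN n, ?_⟩
  have hslice : ∀ X : Config N,
      ∫ t in cell L, (PeriodicTrialState.planeWave hL hN n).ψ (X + fun _ => t) = 0 := by
    intro X
    have hpt : ∀ t : Space, (PeriodicTrialState.planeWave hL hN n).ψ (X + fun _ => t) =
        ((Real.sqrt (∫⁻ X in cellN N L, ((‖planeWaveSum L n X‖₊ : ℝ≥0∞)) ^ 2).toReal)⁻¹ : ℂ) *
          planeWaveSum L n X * cellWave L n t := by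
      intro t
      rw [PeriodicTrialState.planeWave, PeriodicTrialState.ofFun_apply]
      simp only [planeWaveSum, Pi.add_apply, cellWave_add, Finset.sum_mul, Finset.mul_sum, mul_assoc]
    simp_rw [hpt]
    rw [integral_const_mul, integral_cell_cellWave_eq_zero hL hn, mul_zero]
  refine (lintegral_congr fun X => ?_).trans lintegral_zero
  rw [hslice X]
  simp

/-- The pinned problem with no bosons has energy `0` (in particular it is finite). [folklore] -/
theorem recoilTransfer_impurityEnergy_zero_bosons (v : ℝ → ℝ≥0∞) (L : ℝ) :
    impurityPeriodicGroundStateEnergy v 0 L 0 ≠ ⊤ := by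
  -- the constant function `1` on the one-point configuration space is admissible with energy `0`
  have hvol : volume (cellN 0 L) = 1 := by rw [volume_cellN, pow_zero]
  let Φ : PeriodicTrialState 0 L :=
    { ψ := fun _ => 1
      contDiff := contDiff_const
      periodic := fun _ i _ => Fin.elim0 i
      symm := fun _ _ => rfl
      norm_eq := by rw [setLIntegral_const, hvol]; simp }
  refine ne_top_of_le_ne_top (b := impurityPeriodicEnergy v 0 Φ) ?_
    (impurityPeriodicGroundStateEnergy_le v 0 Φ)
  rw [impurityPeriodicEnergy_eq, periodicEnergy]
  have h0 : ∀ X : Config 0, kineticDensity Φ.ψ X +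
      periodicInteraction v L X * (‖Φ.ψ X‖₊ : ℝ≥0∞) ^ 2 = 0 := fun X => by
    simp [kineticDensity, periodicInteraction]
  have h1 : ∀ X : Config 0, impurityInteraction v L 0 X * (‖Φ.ψ X‖₊ : ℝ≥0∞) ^ 2 = 0 := fun X => by
    simp [impurityInteraction]
  simp only [h0, h1, lintegral_zero, add_zero]
  exact ENNReal.zero_ne_top

/-! ### Composition -/

/-- **The crux at fixed `(N, ρ)`, from the fixed-`N` bodies of the stubs.** Given the mass flow on the zero
momentum sector at `(N, L = sideLength ρ (N+1))` with loss `ε/2` (body of stub C′) and a TRANSFER at `κ = 1`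
from floors on the zero-total-momentum tagged near-minimisers of `H_1` to `n₀`-floors on all Bose
near-minimisers with an arbitrary loss `η > 0` (supplied by `recoilTransfer_boseTransfer_gap` from a Ky Fan gap, or by
`recoilTransfer_boseTransfer_nearZeroMomentum` from stub D′), the body of `RecoilTransfer` holds at `N` with loss `ε`:
if `E_imp = ⊤` the floor hypothesis is contradictory for `c > ε` (`recoilTransfer_exists_zeroWeight`) and the conclusion
trivial otherwise; else every `E_κ` is finite (A1), the pinned floor `c` is a floor on the `Q = 0`
near-minimisers of `H_κ`, `κ ≤ κ₀` (A1 + A2, no loss), the mass flow carries it to the `Q = 0` near-minimisers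
of `H_1` (loss `ε/2`) and the transfer to all Bose near-minimisers (loss `ε/2`). [folklore] -/
theorem recoilTransfer_at_of_massFlow {v : ℝ → ℝ≥0∞} (hv : IsRepulsiveFiniteRange v) {ε : ℝ} (hε : 0 < ε)
    (N : ℕ) {ρ : ℝ} (hρ : 0 < ρ)
    (hflow : ∀ a : ℝ, ∀ κ₀ : ℝ, 0 < κ₀ → κ₀ ≤ 1 →
      (∀ κ : ℝ, 0 < κ → κ ≤ κ₀ → ∃ δ : ℝ≥0∞, 0 < δ ∧
        ∀ Ψ : TaggedPeriodicTrialState N (sideLength ρ (N + 1)), HasTotalMomentum 0 Ψ.ψ →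
          taggedPeriodicEnergy v κ Ψ ≤
              taggedPeriodicGroundStateEnergy v κ N (sideLength ρ (N + 1)) + δ →
            ENNReal.ofReal a ≤ taggedZeroModeOccupation N (sideLength ρ (N + 1)) Ψ.ψ) →
      ∃ δ' : ℝ≥0∞, 0 < δ' ∧
        ∀ Ψ : TaggedPeriodicTrialState N (sideLength ρ (N + 1)), HasTotalMomentum 0 Ψ.ψ →
          taggedPeriodicEnergy v 1 Ψ ≤
              taggedPeriodicGroundStateEnergy v 1 N (sideLength ρ (N + 1)) + δ' →
            ENNReal.ofReal (a - ε / 2) ≤ taggedZeroModeOccupation N (sideLength ρ (N + 1)) Ψ.ψ)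
    (htransfer : 0 < sideLength ρ (N + 1) →
      periodicGroundStateEnergy v (N + 1) (sideLength ρ (N + 1)) ≠ ⊤ →
        ∀ a : ℝ, ∀ η : ℝ, 0 < η →
          (∃ δ' : ℝ≥0∞, 0 < δ' ∧
            ∀ Ψ : TaggedPeriodicTrialState N (sideLength ρ (N + 1)), HasTotalMomentum 0 Ψ.ψ →
              taggedPeriodicEnergy v 1 Ψ ≤
                  taggedPeriodicGroundStateEnergy v 1 N (sideLength ρ (N + 1)) + δ' →
                ENNReal.ofReal a ≤ taggedZeroModeOccupation N (sideLength ρ (N + 1)) Ψ.ψ) →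
          ∃ δ₂ : ℝ≥0∞, 0 < δ₂ ∧ ∀ Ω : PeriodicTrialState (N + 1) (sideLength ρ (N + 1)),
            periodicEnergy v Ω ≤ periodicGroundStateEnergy v (N + 1) (sideLength ρ (N + 1)) + δ₂ →
              ENNReal.ofReal ((a - η) * ((N + 1 : ℕ) : ℝ)) ≤
                condensateOccupation (N + 1) (sideLength ρ (N + 1)) Ω.ψ) :
    ∀ c : ℝ, ∀ δ₁ : ℝ≥0∞, 0 < δ₁ →
      (∀ Φ : PeriodicTrialState N (sideLength ρ (N + 1)),
        impurityPeriodicEnergy v 0 Φ ≤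
            impurityPeriodicGroundStateEnergy v N (sideLength ρ (N + 1)) 0 + δ₁ →
          ENNReal.ofReal (c * sideLength ρ (N + 1) ^ 6) ≤
            ∫⁻ X in cellN N (sideLength ρ (N + 1)),
              (‖∫ t in cell (sideLength ρ (N + 1)), Φ.ψ (X + fun _ => t)‖₊ : ℝ≥0∞) ^ 2) →
      ∃ δ₂ : ℝ≥0∞, 0 < δ₂ ∧
        ∀ Ω : PeriodicTrialState (N + 1) (sideLength ρ (N + 1)),
          periodicEnergy v Ω ≤
              periodicGroundStateEnergy v (N + 1) (sideLength ρ (N + 1)) + δ₂ →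
            ENNReal.ofReal ((c - ε) * ((N + 1 : ℕ) : ℝ)) ≤
              condensateOccupation (N + 1) (sideLength ρ (N + 1)) Ω.ψ := by
  intro c δ₁ hδ₁ hfloor
  -- the torus has positive side
  have hL : 0 < sideLength ρ (N + 1) := by
    unfold sideLength
    exact Real.rpow_pos_of_pos (div_pos (by exact_mod_cast Nat.succ_pos N) hρ) _
  set L := sideLength ρ (N + 1) with hL_def
  -- case split on the finiteness of the pinned infimum
  by_cases hE : impurityPeriodicGroundStateEnergy v N L 0 = ⊤
  · -- degenerate branch: every pinned state is a δ₁-near-minimiser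
    rcases le_or_gt c ε with hcε | hcε
    · -- the conclusion is trivial
      refine ⟨1, one_pos, fun Ω _ => ?_⟩
      have hnp : (c - ε) * ((N + 1 : ℕ) : ℝ) ≤ 0 :=
        mul_nonpos_of_nonpos_of_nonneg (by linarith) (Nat.cast_nonneg _)
      rw [ENNReal.ofReal_of_nonpos hnp]
      exact bot_le
    · -- the floor hypothesis is contradictory: `N ≥ 1` and the zero-weight witness
      exfalso
      have hN : 0 < N := by
        rcases Nat.eq_zero_or_pos N with h0 | h0
        · exact absurd hE (by subst h0; exact recoilTransfer_impurityEnergy_zero_bosons v L)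
        · exact h0
      obtain ⟨Φ, hW⟩ := recoilTransfer_exists_zeroWeight hL hN
      have h := hfloor Φ (by rw [hE, top_add]; exact le_top)
      rw [hW, nonpos_iff_eq_zero, ENNReal.ofReal_eq_zero] at h
      have : 0 < c * L ^ 6 := by
        have hc : 0 < c := lt_trans hε hcε
        positivity
      linarith
  · -- main branch: `E_κ < ∞` for every `κ` (lift of a `1`-near-minimiser)
    have hEκ : ∀ κ : ℝ, taggedPeriodicGroundStateEnergy v κ N L ≠ ⊤ := by
      intro κ
      have hlt : impurityPeriodicGroundStateEnergy v N L 0 <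
          impurityPeriodicGroundStateEnergy v N L 0 + 1 := ENNReal.lt_add_right hE one_ne_zero
      obtain ⟨χ, hχ⟩ : ∃ χ : PeriodicTrialState N L, impurityPeriodicEnergy v 0 χ <
          impurityPeriodicGroundStateEnergy v N L 0 + 1 := iInf_lt_iff.1 hlt
      refine ne_top_of_le_ne_top ?_ (stub_zeroMomentumLift v hv.1 N L hL κ χ)
      exact ENNReal.mul_ne_top
        (ENNReal.add_ne_top.2 ⟨ENNReal.one_ne_top,
          ENNReal.mul_ne_top ENNReal.ofReal_ne_top (ENNReal.natCast_ne_top N)⟩)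
        (ne_top_of_lt hχ)
    -- the bosonic energy is finite (bosonic floor at `κ = 1`), hence the transfer is available
    have hEB : periodicGroundStateEnergy v (N + 1) L ≠ ⊤ := by
      rw [← taggedPeriodicGroundStateEnergy_one_eq hv.1]
      exact hEκ 1
    -- endpoint on the zero-momentum sector (stubs A1 + A2, no loss)
    obtain ⟨κ₀, hκ₀, hκ₀1, hκ⟩ := recoilTransfer_staticEndpoint_zero_of hv.1 hL c hδ₁ hfloor
    -- mass flow on the zero-momentum sector to κ = 1 (stub C′, loss ε/2)
    obtain ⟨δ', hδ', hfl⟩ := hflow c κ₀ hκ₀ hκ₀1 hκ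
    -- transfer at κ = 1 to all Bose near-minimisers (loss ε/2)
    obtain ⟨δ₂, hδ₂, hΩ⟩ := htransfer hL hEB (c - ε / 2) (ε / 2) (half_pos hε) ⟨δ', hδ', hfl⟩
    refine ⟨δ₂, hδ₂, fun Ω hΩE => ?_⟩
    have hce : c - ε / 2 - ε / 2 = c - ε := by ring
    simpa only [hce] using hΩ Ω hΩE

/-! ### The reduction -/

/-- **The crux `RecoilTransfer` reduced to the mass flow on the zero-momentum sector** (registered name;
the hypothesis is verbatim the body of the registered stub `stub_massFlowZeroMomentum` of skeleton v7): at low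
density, eventually in `N`, IF floors `A ≥ a` on the zero-total-momentum near-minimisers of the mass-deformed
tagged Hamiltonians `H_κ`, `κ ∈ (0, κ₀]`, always give the floor `A ≥ a - ε` on the zero-total-momentum
near-minimisers of `H_1`, THEN `RecoilTransfer` holds. Proof: three-way split on the profile (locally bounded
on `(0,∞)` / integrable / hard wall) deciding which `κ = 1` transfer is used, `ρ₀ = min`, intersection of the
eventual-`N` sets, then `recoilTransfer_at_of_massFlow`. [folklore] -/
theorem recoilTransfer_of_massFlowZeroMomentum :
    (∀ v : ℝ → ℝ≥0∞, IsRepulsiveFiniteRange v → ∀ ε : ℝ, 0 < ε →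
      ∃ ρ₀ : ℝ, 0 < ρ₀ ∧ ∀ ρ : ℝ, 0 < ρ → ρ < ρ₀ → ∀ᶠ N : ℕ in Filter.atTop,
        ∀ a : ℝ, ∀ κ₀ : ℝ, 0 < κ₀ → κ₀ ≤ 1 →
          (∀ κ : ℝ, 0 < κ → κ ≤ κ₀ → ∃ δ : ℝ≥0∞, 0 < δ ∧
            ∀ Ψ : TaggedPeriodicTrialState N (sideLength ρ (N + 1)), HasTotalMomentum 0 Ψ.ψ →
              taggedPeriodicEnergy v κ Ψ ≤
                  taggedPeriodicGroundStateEnergy v κ N (sideLength ρ (N + 1)) + δ →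
                ENNReal.ofReal a ≤ taggedZeroModeOccupation N (sideLength ρ (N + 1)) Ψ.ψ) →
          ∃ δ' : ℝ≥0∞, 0 < δ' ∧
            ∀ Ψ : TaggedPeriodicTrialState N (sideLength ρ (N + 1)), HasTotalMomentum 0 Ψ.ψ →
              taggedPeriodicEnergy v 1 Ψ ≤
                  taggedPeriodicGroundStateEnergy v 1 N (sideLength ρ (N + 1)) + δ' →
                ENNReal.ofReal (a - ε) ≤ taggedZeroModeOccupation N (sideLength ρ (N + 1)) Ψ.ψ) →
    Summit.AtomisticToContinuum.BoseEinsteinCondensation.Theses.BECProbeMassFlow.RecoilTransfer := by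
  intro hflow v hv ε hε
  obtain ⟨ρ₂, hρ₂, h₂⟩ := hflow v hv (ε / 2) (half_pos hε)
  by_cases hlb : ∀ d : ℝ, 0 < d → ∃ M : ℝ≥0∞, M ≠ ⊤ ∧ ∀ r : ℝ, d < r → v r ≤ M
  · -- (a) locally bounded on `(0, ∞)`: the sibling's Ky Fan gap, as soon as `L > 2R₀`
    obtain ⟨R₀, hR₀⟩ := hv.2
    refine ⟨ρ₂, hρ₂, fun ρ hρ hρlt => ?_⟩
    have hLt : Tendsto (fun n : ℕ => sideLength ρ (n + 1)) atTop atTop :=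
      (tendsto_sideLength_atTop hρ).comp (tendsto_add_atTop_nat 1)
    filter_upwards [h₂ ρ hρ hρlt, hLt.eventually_gt_atTop (2 * R₀)] with N hN₂ h2R
    exact recoilTransfer_at_of_massFlow hv hε N hρ hN₂ fun hL hEB a η hη hfloor =>
      recoilTransfer_boseTransfer_gap hv.1 hL hEB
        (kyFanGap_of_locallyBounded v hv hlb R₀ hR₀ (N + 1) _ hL h2R hEB) a hη hfloor
  · by_cases hint : (∫⁻ x : Space, v ‖x‖) = ⊤
    · -- (c) hard walls: the gap-free transfer from stubs D′α + D′β
      obtain ⟨ρ₁, hρ₁, h₁⟩ := recoilTransfer_hardWallNearZeroMomentum v hv hint hlb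
      refine ⟨min ρ₁ ρ₂, lt_min hρ₁ hρ₂, fun ρ hρ hρlt => ?_⟩
      have hρ1 : ρ < ρ₁ := lt_of_lt_of_le hρlt (min_le_left _ _)
      have hρ2 : ρ < ρ₂ := lt_of_lt_of_le hρlt (min_le_right _ _)
      filter_upwards [h₁ ρ hρ hρ1, h₂ ρ hρ hρ2] with N hN₁ hN₂
      exact recoilTransfer_at_of_massFlow hv hε N hρ hN₂ fun hL hEB a η hη hfloor =>
        recoilTransfer_boseTransfer_nearZeroMomentum hv.1 hL (hN₁ hEB) a hη hfloor
    · -- (b) integrable (not locally bounded): Reed–Simon XIII.48(a) on the torus, every `(N, L)`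
      refine ⟨ρ₂, hρ₂, fun ρ hρ hρlt => ?_⟩
      filter_upwards [h₂ ρ hρ hρlt] with N hN₂
      exact recoilTransfer_at_of_massFlow hv hε N hρ hN₂ fun hL hEB a η hη hfloor =>
        recoilTransfer_boseTransfer_gap hv.1 hL hEB
          (PeriodicGroundStateNondegenerateIntegrable_holds (N + 1) (sideLength ρ (N + 1)) v
            (Nat.succ_le_succ (Nat.zero_le N)) hL hv.1 hint) a hη hfloor


end Summit.AtomisticToContinuum.BoseEinsteinCondensation.Theorems

end
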